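import Mathlib
import Literature.Geometry.Riemannian.MeanConvexProfile
import HarnessLib

/-! # Stub `helper_rampLimit` of line `Sketch` (crux `EntropyRung.ConicalGap`, stmt-SmoothPoincare4-16589)

Pure measure theory / real analysis (cycle 5, localisation to sublevel sets). On a Borel space `X`
with a measure `μ` finite on compacts, let `f` be continuous with compact sublevel sets `{f ≤ t}`,
let `F, G` be continuous, and suppose the family of test identities

  `∫ (η'(f x) F x + η(f x) G x) dμ = 0` for every compactly supported `C¹` test function `η`.

Then for every level `t`:
* (i) RAMP identity `∫_{f<t} (−F + (t − f) G) dμ = 0` (formally `η = (t − r)₊`, `η' = −1_{r<t}`),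
  with the integrand integrable on `{f < t}`;
* (ii) STEP inequality `F ≥ 0 ⇒ 0 ≤ ∫_{f<t} G dμ` (formally `η = 1_{r<t}`:
  `∫ η(f) G = −∫ η'(f) F ≥ 0`).

How. `S = Real.smoothTransition`; `S' = 0` off `[0, 1]` and `|S'| ≤ K₀` (tree:
`Literature.Geometry.Riemannian.MeanConvexProfile`), so `(y + 1) S'(y)` is bounded
(`rampLimit_exists_bound_deriv`). Steps `σₙ(r) = S(n(t − r) − 1)` (`= 1` for
`n(t − r) ≥ 2`, `= 0` for `r ≥ t − 1/n`, `σₙ' = −n S' ≤ 0`) and ramps `ρₙ(r) = (t − r) σₙ(r)`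
(`ρₙ' = −σₙ − (t − r) n S'`, `|ρₙ'| ≤ 1 + K`). A lower cut-off `S(r − m + 1)` (`f > m` from
compactness of `{f ≤ t}`) makes them compactly supported without changing values or derivatives
at the points `f x` (`rampLimit_test_of_vanish`). At each point the integrands are eventually
constant (plateaus), vanish on `{f ≥ t}`, and are dominated by a continuous function times
`1_{f ≤ t}` (compact, finite measure), so dominated convergence (`rampLimit_tendsto_integral`)
gives (i) as `lim 0 = 0` and (ii) from `∫ σₙ(f) G dμ ≥ 0` (`integral_mono`, `σₙ' F ≤ 0`) via
`ge_of_tendsto'`.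

Everything here is proved; no definition and no named fact is introduced.
-/

noncomputable section

set_option linter.dupNamespace false

open scoped Topology
open MeasureTheory Set Filter Real Literature.Geometry.Riemannian

namespace Summit.SmoothPoincare4.SmoothPoincare4.Theorems.ConicalGapSketch

/-- A global bound for `|(y + 1) S'(y)|`, from the tree's bound `|S'| ≤ K₀`
(`exists_deriv_smoothTransition_bound`) and `S' = 0` off `[0, 1]`
(`deriv_smoothTransition_eq_zero_of_notMem`, both `Literature.Geometry.Riemannian`). -/
theorem rampLimit_exists_bound_deriv :
    ∃ K : ℝ, ∀ y, |(y + 1) * deriv smoothTransition y| ≤ K := by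
  obtain ⟨K₀, hK₀, hK⟩ := exists_deriv_smoothTransition_bound
  refine ⟨2 * K₀, fun y ↦ ?_⟩
  by_cases hy : y ∈ Icc (0 : ℝ) 1
  · rw [abs_mul]
    exact mul_le_mul (abs_le.2 ⟨by linarith [hy.1], by linarith [hy.2]⟩) (hK y) (abs_nonneg _)
      zero_le_two
  · rw [deriv_smoothTransition_eq_zero_of_notMem hy, mul_zero, abs_zero]
    linarith

/-- Chain rule for the step profile `r ↦ S(n(t - r) - 1)`. -/
theorem rampLimit_hasDerivAt_step (t r : ℝ) (n : ℕ) :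
    HasDerivAt (fun r ↦ smoothTransition (n * (t - r) - 1))
      (-((n : ℝ) * deriv smoothTransition (n * (t - r) - 1))) r := by
  have h1 : HasDerivAt (fun r : ℝ ↦ (n : ℝ) * (t - r) - 1) ((n : ℝ) * -1) r :=
    (((hasDerivAt_id' r).const_sub t).const_mul (n : ℝ)).sub_const 1
  have h2 : HasDerivAt smoothTransition (deriv smoothTransition ((n : ℝ) * (t - r) - 1))
      ((n : ℝ) * (t - r) - 1) :=
    ((smoothTransition.contDiff (n := 1)).differentiable_one _).hasDerivAt
  have h3 := h2.comp r h1
  rw [Function.comp_def] at h3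
  refine h3.congr_deriv ?_
  ring

/-- Product rule for the ramp profile `r ↦ (t - r) S(n(t - r) - 1)`. -/
theorem rampLimit_hasDerivAt_ramp (t r : ℝ) (n : ℕ) :
    HasDerivAt (fun r ↦ (t - r) * smoothTransition (n * (t - r) - 1))
      (-smoothTransition (n * (t - r) - 1)
        - (t - r) * ((n : ℝ) * deriv smoothTransition (n * (t - r) - 1))) r := by
  refine (((hasDerivAt_id' r).const_sub t).fun_mul (rampLimit_hasDerivAt_step t r n)).congr_deriv ?_
  ring

/-- `deriv` form of `rampLimit_hasDerivAt_step`. -/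
theorem rampLimit_deriv_step (t r : ℝ) (n : ℕ) :
    deriv (fun r ↦ smoothTransition (n * (t - r) - 1)) r
      = -((n : ℝ) * deriv smoothTransition (n * (t - r) - 1)) :=
  (rampLimit_hasDerivAt_step t r n).deriv

/-- `deriv` form of `rampLimit_hasDerivAt_ramp`. -/
theorem rampLimit_deriv_ramp (t r : ℝ) (n : ℕ) :
    deriv (fun r ↦ (t - r) * smoothTransition (n * (t - r) - 1)) r
      = -smoothTransition (n * (t - r) - 1)
        - (t - r) * ((n : ℝ) * deriv smoothTransition (n * (t - r) - 1)) :=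
  (rampLimit_hasDerivAt_ramp t r n).deriv

/-- Upper plateau: for `r ≥ t` the step profile and `S'` at `n(t - r) - 1 ≤ -1` vanish. -/
theorem rampLimit_plateau_zero {t r : ℝ} (n : ℕ) (h : t ≤ r) :
    smoothTransition (n * (t - r) - 1) = 0 ∧ deriv smoothTransition (n * (t - r) - 1) = 0 := by
  have h0 : (n : ℝ) * (t - r) ≤ 0 := mul_nonpos_of_nonneg_of_nonpos n.cast_nonneg (sub_nonpos.2 h)
  exact ⟨smoothTransition.zero_of_nonpos (by linarith),
    deriv_smoothTransition_eq_zero_of_notMem fun hy ↦ by linarith [hy.1]⟩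

/-- Lower plateau: for `n(t - r) > 2` the step profile is `1` and `S'` vanishes there. -/
theorem rampLimit_plateau_one {t r : ℝ} {n : ℕ} (h : 2 < n * (t - r)) :
    smoothTransition (n * (t - r) - 1) = 1 ∧ deriv smoothTransition (n * (t - r) - 1) = 0 :=
  ⟨smoothTransition.one_of_one_le (by linarith),
    deriv_smoothTransition_eq_zero_of_notMem fun hy ↦ by linarith [hy.2]⟩

/-- Archimedes: below the level, `r < t`, eventually `n(t - r) > 2`. -/
theorem rampLimit_eventually_plateau {t r : ℝ} (h : r < t) :
    ∃ N : ℕ, ∀ n ≥ N, 2 < (n : ℝ) * (t - r) := by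
  obtain ⟨N, hN⟩ := exists_nat_gt (2 / (t - r))
  refine ⟨N, fun n hn ↦ ?_⟩
  have h1 : 2 < (N : ℝ) * (t - r) := (div_lt_iff₀ (sub_pos.2 h)).1 hN
  have h2 : (N : ℝ) * (t - r) ≤ n * (t - r) :=
    mul_le_mul_of_nonneg_right (Nat.cast_le.2 hn) (sub_pos.2 h).le
  linarith

section Truncation

variable {X : Type*} [MeasurableSpace X] {μ : Measure X} {f F G : X → ℝ} {t : ℝ}

/-- **Lower cut-off.** If `f > m` everywhere and the test identity holds for compactly supported
`C¹` test functions, it holds for every `C¹` profile `ρ` vanishing on `[t, ∞)`: multiply `ρ` by the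
smooth cut-off `S(r - m + 1)`, which is `1` near every value `f x` and `0` below `m - 1`. -/
theorem rampLimit_test_of_vanish {m : ℝ} (hm : ∀ x, m < f x)
    (hH : ∀ η : ℝ → ℝ, ContDiff ℝ 1 η → HasCompactSupport η →
      ∫ x, (deriv η (f x) * F x + η (f x) * G x) ∂μ = 0)
    {ρ : ℝ → ℝ} (hρ : ContDiff ℝ 1 ρ) (hρ0 : ∀ r, t ≤ r → ρ r = 0) :
    ∫ x, (deriv ρ (f x) * F x + ρ (f x) * G x) ∂μ = 0 := by
  set η : ℝ → ℝ := fun r ↦ smoothTransition (r - m + 1) * ρ r with hη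
  have hηρ : ∀ x, η =ᶠ[𝓝 (f x)] ρ := fun x ↦ by
    filter_upwards [Ioi_mem_nhds (hm x)] with r hr
    show smoothTransition (r - m + 1) * ρ r = ρ r
    rw [smoothTransition.one_of_one_le (by linarith [show m < r from hr]), one_mul]
  have h1 : ∀ x, deriv η (f x) = deriv ρ (f x) := fun x ↦ (hηρ x).deriv_eq
  have h2 : ∀ x, η (f x) = ρ (f x) := fun x ↦ (hηρ x).eq_of_nhds
  have hηc : ContDiff ℝ 1 η := by rw [hη]; fun_prop
  have hηs : HasCompactSupport η := by
    refine HasCompactSupport.intro (isCompact_Icc (a := m - 1) (b := t)) fun r hr ↦ ?_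
    simp only [mem_Icc, not_and_or, not_le] at hr
    show smoothTransition (r - m + 1) * ρ r = 0
    rcases hr with hr | hr
    · rw [smoothTransition.zero_of_nonpos (by linarith), zero_mul]
    · rw [hρ0 r hr.le, mul_zero]
  simpa only [h1, h2] using hH η hηc hηs

variable [TopologicalSpace X] [OpensMeasurableSpace X] [IsFiniteMeasureOnCompacts μ]

/-- A continuous function vanishing on `{f ≥ t}` is integrable when `{f ≤ t}` is compact. -/
theorem rampLimit_integrable_of_vanish (hf : Continuous f) (hK : IsCompact {x | f x ≤ t})
    {Φ : X → ℝ} (hΦ : Continuous Φ) (h0 : ∀ x, t ≤ f x → Φ x = 0) : Integrable Φ μ := by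
  have hmeas : MeasurableSet {x | f x ≤ t} := (isClosed_le hf continuous_const).measurableSet
  have h : {x | f x ≤ t}.indicator Φ = Φ := by
    refine indicator_eq_self.2 fun x hx ↦ ?_
    by_contra h
    exact hx (h0 x (le_of_lt (not_le.1 h)))
  rw [← h]
  exact (integrable_indicator_iff hmeas).2 (hΦ.continuousOn.integrableOn_compact' hK hmeas)

/-- **Dominated convergence on a compact sublevel set.** Continuous `Θ n` vanishing on `{f ≥ t}`,
bounded by a continuous `B` on `{f < t}` and eventually equal to `θ` at each point of `{f < t}`,
have `∫ Θ n dμ → ∫_{f<t} θ dμ` (bound: `|B| · 1_{f ≤ t}`, integrable as `{f ≤ t}` is compact). -/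
theorem rampLimit_tendsto_integral (hf : Continuous f) (hK : IsCompact {x | f x ≤ t})
    {Θ : ℕ → X → ℝ} {θ B : X → ℝ} (hΘ : ∀ n, Continuous (Θ n)) (hB : Continuous B)
    (h0 : ∀ n x, t ≤ f x → Θ n x = 0) (hbd : ∀ n x, f x < t → |Θ n x| ≤ B x)
    (hlim : ∀ x, f x < t → ∃ N : ℕ, ∀ n ≥ N, Θ n x = θ x) :
    Tendsto (fun n ↦ ∫ x, Θ n x ∂μ) atTop (𝓝 (∫ x in {x | f x < t}, θ x ∂μ)) := by
  have hmeas : MeasurableSet {x | f x ≤ t} := (isClosed_le hf continuous_const).measurableSet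
  rw [← integral_indicator (isOpen_lt hf continuous_const).measurableSet]
  refine tendsto_integral_of_dominated_convergence ({x | f x ≤ t}.indicator fun x ↦ |B x|)
    (fun n ↦ (hΘ n).aestronglyMeasurable) ?_ (fun n ↦ Eventually.of_forall fun x ↦ ?_)
    (Eventually.of_forall fun x ↦ ?_)
  · exact (integrable_indicator_iff hmeas).2
      ((continuous_abs.comp hB).continuousOn.integrableOn_compact' hK hmeas)
  · by_cases hx : f x < t
    · rw [indicator_of_mem (show x ∈ {x | f x ≤ t} from hx.le), Real.norm_eq_abs]
      exact (hbd n x hx).trans (le_abs_self _)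
    · rw [h0 n x (not_lt.1 hx), norm_zero]
      exact indicator_nonneg (fun _ _ ↦ abs_nonneg _) _
  · by_cases hx : f x < t
    · obtain ⟨N, hN⟩ := hlim x hx
      rw [indicator_of_mem (show x ∈ {x | f x < t} from hx)]
      exact tendsto_atTop_of_eventually_const hN
    · rw [indicator_of_notMem (show x ∉ {x | f x < t} from hx)]
      exact tendsto_atTop_of_eventually_const (i₀ := 0) fun n _ ↦ h0 n x (not_lt.1 hx)

/-- **Ramp identity** `∫_{f<t} (−F + (t − f) G) dμ = 0`: test against the ramps
`ρₙ(r) = (t − r) S(n(t − r) − 1)` (`ρₙ' → −1_{r<t}`, `ρₙ → (t − r)₊`, eventually constant at each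
point, `|ρₙ'| ≤ 1 + K`, `|ρₙ(r)| ≤ |t − r|`) and pass to the limit by dominated convergence. -/
theorem rampLimit_ramp_identity (hf : Continuous f) (hF : Continuous F) (hG : Continuous G)
    (hK : IsCompact {x | f x ≤ t}) {m : ℝ} (hm : ∀ x, m < f x)
    (hH : ∀ η : ℝ → ℝ, ContDiff ℝ 1 η → HasCompactSupport η →
      ∫ x, (deriv η (f x) * F x + η (f x) * G x) ∂μ = 0) :
    ∫ x in {x | f x < t}, (-F x + (t - f x) * G x) ∂μ = 0 := by
  obtain ⟨K, hK'⟩ := rampLimit_exists_bound_deriv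
  have h0 : ∀ n : ℕ, ∫ x, ((-smoothTransition (n * (t - f x) - 1)
      - (t - f x) * ((n : ℝ) * deriv smoothTransition (n * (t - f x) - 1))) * F x
      + (t - f x) * smoothTransition (n * (t - f x) - 1) * G x) ∂μ = 0 := fun n ↦ by
    have h := rampLimit_test_of_vanish hm hH
      (ρ := fun r ↦ (t - r) * smoothTransition (n * (t - r) - 1)) (by fun_prop)
      (fun r hr ↦ by rw [(rampLimit_plateau_zero n hr).1, mul_zero])
    simpa only [rampLimit_deriv_ramp] using h
  have hlim := rampLimit_tendsto_integral (μ := μ) hf hK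
    (Θ := fun (n : ℕ) x ↦ (-smoothTransition (n * (t - f x) - 1)
      - (t - f x) * ((n : ℝ) * deriv smoothTransition (n * (t - f x) - 1))) * F x
      + (t - f x) * smoothTransition (n * (t - f x) - 1) * G x)
    (θ := fun x ↦ -F x + (t - f x) * G x) (B := fun x ↦ (1 + K) * |F x| + |t - f x| * |G x|)
    (fun n ↦ by fun_prop) (by fun_prop) (fun n x hx ↦ ?_) (fun n x _ ↦ ?_) (fun x hx ↦ ?_)
  · simp only [h0] at hlim
    exact tendsto_nhds_unique hlim tendsto_const_nhds
  · rw [(rampLimit_plateau_zero n hx).1, (rampLimit_plateau_zero n hx).2]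
    ring
  · set y : ℝ := n * (t - f x) - 1 with hy
    have ha0 := smoothTransition.nonneg y
    have ha1 := smoothTransition.le_one y
    have h1 : (t - f x) * ((n : ℝ) * deriv smoothTransition y)
        = (y + 1) * deriv smoothTransition y := by
      rw [hy]; ring
    have e1 : |smoothTransition y * F x| ≤ |F x| := by
      rw [abs_mul, abs_of_nonneg ha0]
      exact mul_le_of_le_one_left (abs_nonneg _) ha1
    have e2 : |(y + 1) * deriv smoothTransition y * F x| ≤ K * |F x| := by
      rw [abs_mul]
      exact mul_le_mul_of_nonneg_right (hK' y) (abs_nonneg _)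
    have e3 : |smoothTransition y * ((t - f x) * G x)| ≤ |t - f x| * |G x| := by
      rw [abs_mul, abs_mul, abs_of_nonneg ha0]
      exact mul_le_of_le_one_left (by positivity) ha1
    rw [h1]
    calc |(-smoothTransition y - (y + 1) * deriv smoothTransition y) * F x
          + (t - f x) * smoothTransition y * G x|
        = |-(smoothTransition y * F x) + -((y + 1) * deriv smoothTransition y * F x)
          + smoothTransition y * ((t - f x) * G x)| := by ring_nf
      _ ≤ |-(smoothTransition y * F x)| + |-((y + 1) * deriv smoothTransition y * F x)|
          + |smoothTransition y * ((t - f x) * G x)| := abs_add_three _ _ _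
      _ ≤ |F x| + K * |F x| + |t - f x| * |G x| := by
          rw [abs_neg, abs_neg]; exact add_le_add (add_le_add e1 e2) e3
      _ = (1 + K) * |F x| + |t - f x| * |G x| := by ring
  · obtain ⟨N, hN⟩ := rampLimit_eventually_plateau hx
    refine ⟨N, fun n hn ↦ ?_⟩
    rw [(rampLimit_plateau_one (hN n hn)).1, (rampLimit_plateau_one (hN n hn)).2]
    ring

/-- **Step inequality** `F ≥ 0 ⇒ ∫_{f<t} G dμ ≥ 0`: test against the steps
`σₙ(r) = S(n(t − r) − 1)`;
since `σₙ' ≤ 0` and `F ≥ 0`, `∫ σₙ(f) G dμ ≥ ∫ (σₙ'(f) F + σₙ(f) G) dμ = 0`, and `∫ σₙ(f) G dμ →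
∫_{f<t} G dμ` by dominated convergence. -/
theorem rampLimit_step_nonneg (hf : Continuous f) (hF : Continuous F) (hG : Continuous G)
    (hK : IsCompact {x | f x ≤ t}) {m : ℝ} (hm : ∀ x, m < f x)
    (hH : ∀ η : ℝ → ℝ, ContDiff ℝ 1 η → HasCompactSupport η →
      ∫ x, (deriv η (f x) * F x + η (f x) * G x) ∂μ = 0) (hF0 : ∀ x, 0 ≤ F x) :
    0 ≤ ∫ x in {x | f x < t}, G x ∂μ := by
  have hlim := rampLimit_tendsto_integral (μ := μ) hf hK
    (Θ := fun (n : ℕ) x ↦ smoothTransition (n * (t - f x) - 1) * G x) (θ := G)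
    (B := fun x ↦ |G x|) (fun n ↦ by fun_prop) (by fun_prop) (fun n x hx ↦ ?_) (fun n x _ ↦ ?_)
    (fun x hx ↦ ?_)
  · refine ge_of_tendsto' hlim fun n ↦ ?_
    have h := rampLimit_test_of_vanish hm hH (ρ := fun r ↦ smoothTransition (n * (t - r) - 1))
      (by fun_prop) (fun r hr ↦ (rampLimit_plateau_zero n hr).1)
    simp only [rampLimit_deriv_step] at h
    rw [← h]
    refine integral_mono (rampLimit_integrable_of_vanish hf hK (by fun_prop) fun x hx ↦ ?_)
      (rampLimit_integrable_of_vanish hf hK (by fun_prop) fun x hx ↦ ?_) fun x ↦ ?_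
    · rw [(rampLimit_plateau_zero n hx).1, (rampLimit_plateau_zero n hx).2]
      ring
    · rw [(rampLimit_plateau_zero n hx).1, zero_mul]
    · have hd := smoothTransition.monotone.deriv_nonneg (x := (n : ℝ) * (t - f x) - 1)
      have : -((n : ℝ) * deriv smoothTransition (n * (t - f x) - 1)) * F x
          + smoothTransition (n * (t - f x) - 1) * G x
          ≤ smoothTransition (n * (t - f x) - 1) * G x := by
        nlinarith [hF0 x, mul_nonneg (n.cast_nonneg (α := ℝ)) hd]
      exact this
  · rw [(rampLimit_plateau_zero n hx).1, zero_mul]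
  · rw [abs_mul, abs_of_nonneg (smoothTransition.nonneg _)]
    exact mul_le_of_le_one_left (abs_nonneg _) (smoothTransition.le_one _)
  · obtain ⟨N, hN⟩ := rampLimit_eventually_plateau hx
    exact ⟨N, fun n hn ↦ by rw [(rampLimit_plateau_one (hN n hn)).1, one_mul]⟩

end Truncation

/-- **Stub `helper_rampLimit` (RL) of line `Sketch`.** For a continuous `f` with compact sublevel
sets on a Borel space with a measure finite on compacts, continuous `F, G`, and the family of test
identities `∫ (η'(f) F + η(f) G) dμ = 0` over compactly supported `C¹` test functions `η`: for every
level `t`, (i) the ramp identity `∫_{f<t} (−F + (t − f) G) dμ = 0` (with its integrand integrable on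
`{f < t}`), and (ii) the step inequality `F ≥ 0 ⇒ 0 ≤ ∫_{f<t} G dμ`. -/
theorem helper_rampLimit : ∀ (X : Type) [TopologicalSpace X] [MeasurableSpace X] [BorelSpace X] (μ : MeasureTheory.Measure X) [MeasureTheory.IsFiniteMeasureOnCompacts μ] (f F G : X → ℝ), Continuous f → Continuous F → Continuous G → (∀ t : ℝ, IsCompact {x | f x ≤ t}) → (∀ η : ℝ → ℝ, ContDiff ℝ 1 η → HasCompactSupport η → ∫ x, (deriv η (f x) * F x + η (f x) * G x) ∂μ = 0) → ∀ t : ℝ, (MeasureTheory.IntegrableOn (fun x ↦ -F x + (t - f x) * G x) {x | f x < t} μ ∧ ∫ x in {x | f x < t}, (-F x + (t - f x) * G x) ∂μ = 0) ∧ ((∀ x, 0 ≤ F x) → 0 ≤ ∫ x in {x | f x < t}, G x ∂μ) := by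
  intro X _ _ _ μ _ f F G hf hF hG hK hH t
  obtain ⟨m, hm⟩ : ∃ m : ℝ, ∀ x, m < f x := by
    obtain ⟨b, hb⟩ := (hK t).bddBelow_image hf.continuousOn
    refine ⟨min b t - 1, fun x ↦ ?_⟩
    have h1 := min_le_left b t
    have h2 := min_le_right b t
    by_cases hx : f x ≤ t
    · have h3 : b ≤ f x := hb (mem_image_of_mem f hx)
      linarith
    · linarith [not_le.1 hx]
  refine ⟨⟨?_, rampLimit_ramp_identity hf hF hG (hK t) hm hH⟩,
    rampLimit_step_nonneg hf hF hG (hK t) hm hH⟩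
  have hc : Continuous fun x ↦ -F x + (t - f x) * G x := by fun_prop
  exact (hc.continuousOn.integrableOn_compact' (hK t)
    (isClosed_le hf continuous_const).measurableSet).mono_set
      fun x hx ↦ show f x ≤ t from le_of_lt hx

end Summit.SmoothPoincare4.SmoothPoincare4.Theorems.ConicalGapSketch

end
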